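import Mathlib
import Summits.Ventures.PercRepro2.Defs
import Summits.Ventures.PercRepro2.Graph
import Summits.Ventures.PercRepro2.RestrictClosure
import Summits.Ventures.PercRepro2.GcBlockPush

/-!
# Two-terminal blocks: connectivity through a block is connectivity of its terminals (blind cell
PercRepro2, typer-1 g54)

A **two-terminal block** (`IsBlock ends W u v`) is a vertex set `W` with two terminals
`u, v ∉ W` such that every edge touching `W` has both ends in `W ∪ {u, v}`. For the edge set
`S = touches ends W` and a chosen `e₀ ∈ S`:

* **`blockEnds ends S e₀ u v`** — the incidence map with `e₀` re-wired to `{u, v}` and every other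
  edge of `S` made a loop; **`blockObs ends S u v`** — the observable «`u ↔ v` inside `S`»
  (`Conn ends (restrictTo S ω) u v`), determined by the edges of `S` (`dependsOn_blockObs`);
* **`conn_block_iff`** — for two vertices `x, z ∉ W`: `x ↔ z` in the collapsed graph under
  `blockMap S e₀ (blockObs …) ω` iff `x ↔ z` in the original graph under `ω`. Both directions
  are closure arguments (`mem_of_conn_of_closed'`): a walk of the original graph crosses `W` only
  between terminals, and a crossing means `u ↔ v` inside `S`, which is the open edge `e₀`; a walk
  of the collapsed graph uses `e₀` only when `u ↔ v` inside `S`.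

With `GcBlockPush.lean` this gives the exact block reduction of the covariance form
(`GcBlock.lean`): a mark-free two-terminal block is one edge of weight `P(u ↔ v inside the block)`.
-/

namespace Summit.Ventures.PercRepro2

open SepPair

namespace Block

/-! ## The block and its collapsed incidence map -/

section Defs

variable {V : Type*} {E : Type*} [DecidableEq E]

/-- **A two-terminal block**: the terminals are outside `W`, and every edge touching `W` has both
of its ends in `W ∪ {u, v}`. -/
structure IsBlock (ends : E → Sym2 V) (W : Set V) (u v : V) : Prop where
  /-- `u ∉ W` -/
  u_notMem : u ∉ W
  /-- `v ∉ W` -/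
  v_notMem : v ∉ W
  /-- every edge touching `W` has both ends in `W ∪ {u, v}` -/
  ends_mem : ∀ e ∈ touches ends W, ∀ x y, ends e = s(x, y) →
    (x ∈ W ∨ x = u ∨ x = v) ∧ (y ∈ W ∨ y = u ∨ y = v)

/-- **The collapsed incidence map**: `e₀` is re-wired to `{u, v}`, every other edge of `S`
becomes a loop at `u`, the edges outside `S` are unchanged. -/
def blockEnds (ends : E → Sym2 V) (S : Set E) [DecidablePred (· ∈ S)] (e₀ : E) (u v : V) :
    E → Sym2 V :=
  fun e => if e = e₀ then s(u, v) else if e ∈ S then s(u, u) else ends e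

open Classical in
/-- **The block observable**: `u ↔ v` inside the edges of `S`. -/
noncomputable def blockObs (ends : E → Sym2 V) (S : Set E) [DecidablePred (· ∈ S)] (u v : V) :
    Config E → Bool :=
  fun ω => decide (Conn ends (restrictTo S ω) u v)

/-- `blockEnds` at `e₀`. -/
lemma blockEnds_apply_self (ends : E → Sym2 V) (S : Set E) [DecidablePred (· ∈ S)] (e₀ : E)
    (u v : V) : blockEnds ends S e₀ u v e₀ = s(u, v) := by
  simp [blockEnds]

/-- `blockEnds` on an edge of `S` other than `e₀`. -/
lemma blockEnds_apply_of_mem {ends : E → Sym2 V} {S : Set E} [DecidablePred (· ∈ S)] {e₀ : E}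
    {u v : V} {e : E} (hne : e ≠ e₀) (he : e ∈ S) : blockEnds ends S e₀ u v e = s(u, u) := by
  simp [blockEnds, hne, he]

/-- `blockEnds` on an edge outside `S` (`e₀ ∈ S`). -/
lemma blockEnds_apply_of_notMem {ends : E → Sym2 V} {S : Set E} [DecidablePred (· ∈ S)]
    {e₀ : E} (he₀ : e₀ ∈ S) {u v : V} {e : E} (he : e ∉ S) :
    blockEnds ends S e₀ u v e = ends e := by
  have hne : e ≠ e₀ := fun h => he (h ▸ he₀)
  simp [blockEnds, hne, he]

/-- `blockMap` at `e₀`. -/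
lemma blockMap_apply_self (S : Set E) [DecidablePred (· ∈ S)] (e₀ : E) (β : Config E → Bool)
    (ω : Config E) : blockMap S e₀ β ω e₀ = β ω := by
  simp [blockMap]

/-- `blockMap` on an edge of `S` other than `e₀`: closed. -/
lemma blockMap_apply_of_mem {S : Set E} [DecidablePred (· ∈ S)] {e₀ : E} {β : Config E → Bool}
    {ω : Config E} {e : E} (hne : e ≠ e₀) (he : e ∈ S) : blockMap S e₀ β ω e = false := by
  simp [blockMap, hne, he]

/-- `blockMap` on an edge outside `S` (`e₀ ∈ S`): unchanged. -/
lemma blockMap_apply_of_notMem {S : Set E} [DecidablePred (· ∈ S)] {e₀ : E} (he₀ : e₀ ∈ S)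
    {β : Config E → Bool} {ω : Config E} {e : E} (he : e ∉ S) : blockMap S e₀ β ω e = ω e := by
  have hne : e ≠ e₀ := fun h => he (h ▸ he₀)
  simp [blockMap, hne, he]

omit [DecidableEq E] in
/-- The block observable is determined by the edges of `S`. -/
lemma dependsOn_blockObs (ends : E → Sym2 V) (S : Set E) [DecidablePred (· ∈ S)] (u v : V) :
    DependsOn (blockObs ends S u v) S := by
  intro ω ω' h
  have hr : restrictTo S ω = restrictTo S ω' := restrictTo_eq_of_eqOn h
  unfold blockObs
  rw [hr]

omit [DecidableEq E] in
/-- The block observable is `true` iff `u ↔ v` inside `S`. -/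
lemma blockObs_eq_true_iff (ends : E → Sym2 V) (S : Set E) [DecidablePred (· ∈ S)] (u v : V)
    (ω : Config E) : blockObs ends S u v ω = true ↔ Conn ends (restrictTo S ω) u v := by
  simp only [blockObs, decide_eq_true_iff]

end Defs

/-! ## Connectivity through the block -/

section Conn

variable {V : Type*} {E : Type*} [DecidableEq E]

/-- **Connectivity is carried by the collapse (from the original graph)**: if `x ↔ z` under `ω`
with `x, z ∉ W`, then `x ↔ z` in the collapsed graph under the block map. Stated with the
collapsed data `ends'`, `ω'` given by their defining equations. -/
lemma conn_block_of_conn {ends : E → Sym2 V} {W : Set V} {u v : V} (hB : IsBlock ends W u v)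
    {S : Set E} [DecidablePred (· ∈ S)] (hS : ∀ e, e ∈ S ↔ e ∈ touches ends W) {e₀ : E}
    (he₀ : e₀ ∈ S) {ends' : E → Sym2 V} (hends' : ends' = blockEnds ends S e₀ u v)
    {ω ω' : Config E} (hω' : ω' = blockMap S e₀ (blockObs ends S u v) ω) {x z : V} (hx : x ∉ W)
    (hz : z ∉ W) (h : Conn ends ω x z) : Conn ends' ω' x z := by
  -- the crossing of the block along `e₀`
  have hcross : ∀ t t' : V, (t = u ∨ t = v) → (t' = u ∨ t' = v) → t ≠ t' →
      Conn ends (restrictTo S ω) t t' → OpenAdj ends' ω' t t' := by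
    intro t t' ht ht' hne hc
    have huv : Conn ends (restrictTo S ω) u v := by
      rcases ht with rfl | rfl <;> rcases ht' with rfl | rfl
      · exact absurd rfl hne
      · exact hc
      · exact conn_symm hc
      · exact absurd rfl hne
    have hopen : ω' e₀ = true := by
      rw [hω', blockMap_apply_self, blockObs_eq_true_iff]
      exact huv
    have hend : ends' e₀ = s(u, v) := by
      rw [hends', blockEnds_apply_self]
    rcases ht with rfl | rfl <;> rcases ht' with rfl | rfl
    · exact absurd rfl hne
    · exact ⟨e₀, hopen, hend⟩
    · exact ⟨e₀, hopen, by rw [hend, Sym2.eq_swap]⟩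
    · exact absurd rfl hne
  -- the closure set
  let T : Set V := {y | (y ∉ W ∧ Conn ends' ω' x y) ∨
    (y ∈ W ∧ ∃ t, (t = u ∨ t = v) ∧ Conn ends' ω' x t ∧ Conn ends (restrictTo S ω) t y)}
  have hxT : x ∈ T := Or.inl ⟨hx, conn_refl _ _ _⟩
  have hclosed : ∀ e y y', ω e = true → ends e = s(y, y') → y ∈ T → y' ∈ T := by
    intro e y y' he hends hy
    by_cases heS : e ∈ S
    · -- an edge of the block: both ends in `W ∪ {u, v}`, open inside `S`
      obtain ⟨hy1, hy'1⟩ := hB.ends_mem e ((hS e).1 heS) y y' hends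
      have heS' : restrictTo S ω e = true := restrictTo_eq_true_of_mem heS he
      have hadj : Conn ends (restrictTo S ω) y y' := conn_of_openAdj ⟨e, heS', hends⟩
      -- the terminal reaching `y`, and the connection `t ↔ y'` inside `S`
      obtain ⟨t, ht, hxt, hty'⟩ : ∃ t, (t = u ∨ t = v) ∧ Conn ends' ω' x t ∧
          Conn ends (restrictTo S ω) t y' := by
        rcases hy with ⟨hyW, hxy⟩ | ⟨hyW, t, ht, hxt, hty⟩
        · rcases hy1 with hyW' | ht
          · exact absurd hyW' hyW
          · exact ⟨y, ht, hxy, hadj⟩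
        · exact ⟨t, ht, hxt, conn_trans hty hadj⟩
      rcases hy'1 with hy'W | ht'
      · exact Or.inr ⟨hy'W, t, ht, hxt, hty'⟩
      · have hy'W : y' ∉ W := by
          rcases ht' with rfl | rfl
          · exact hB.u_notMem
          · exact hB.v_notMem
        by_cases htt : t = y'
        · subst htt
          exact Or.inl ⟨hy'W, hxt⟩
        · exact Or.inl ⟨hy'W, conn_trans hxt (conn_of_openAdj (hcross t y' ht ht' htt hty'))⟩
    · -- an edge outside the block: unchanged in the collapse, both ends outside `W`
      have hyW : y ∉ W := fun hw => heS ((hS e).2 (mem_touches_of_ends hends (Or.inl hw)))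
      have hy'W : y' ∉ W := fun hw => heS ((hS e).2 (mem_touches_of_ends hends (Or.inr hw)))
      have hxy : Conn ends' ω' x y := by
        rcases hy with ⟨_, hxy⟩ | ⟨hyW', _⟩
        · exact hxy
        · exact absurd hyW' hyW
      have hopen : ω' e = true := by
        rw [hω', blockMap_apply_of_notMem he₀ heS]
        exact he
      have hend : ends' e = s(y, y') := by
        rw [hends', blockEnds_apply_of_notMem he₀ heS]
        exact hends
      exact Or.inl ⟨hy'W, conn_trans hxy (conn_of_openAdj ⟨e, hopen, hend⟩)⟩
  have hzT : z ∈ T := mem_of_conn_of_closed' hclosed hxT h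
  rcases hzT with ⟨_, hxz⟩ | ⟨hzW, _⟩
  · exact hxz
  · exact absurd hzW hz

/-- **Connectivity is carried by the collapse (to the original graph)**: if `x ↔ z` in the
collapsed graph under the block map, then `x ↔ z` under `ω`. -/
lemma conn_of_conn_block {ends : E → Sym2 V} {S : Set E} [DecidablePred (· ∈ S)] {e₀ : E}
    (he₀ : e₀ ∈ S) {u v : V} {ends' : E → Sym2 V} (hends' : ends' = blockEnds ends S e₀ u v)
    {ω ω' : Config E} (hω' : ω' = blockMap S e₀ (blockObs ends S u v) ω) {x z : V}
    (h : Conn ends' ω' x z) : Conn ends ω x z := by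
  let T : Set V := {y | Conn ends ω x y}
  have hxT : x ∈ T := conn_refl _ _ _
  have hclosed : ∀ e y y', ω' e = true → ends' e = s(y, y') → y ∈ T → y' ∈ T := by
    intro e y y' he hends hy
    by_cases he0 : e = e₀
    · -- the collapsed edge: open only when `u ↔ v` inside `S`
      subst he0
      have huv : Conn ends (restrictTo S ω) u v := by
        rw [hω', blockMap_apply_self, blockObs_eq_true_iff] at he
        exact he
      have huv' : Conn ends ω u v := conn_of_conn_restrictTo huv
      rw [hends', blockEnds_apply_self, Sym2.eq_iff] at hends
      rcases hends with ⟨rfl, rfl⟩ | ⟨rfl, rfl⟩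
      · exact conn_trans hy huv'
      · exact conn_trans hy (conn_symm huv')
    · by_cases heS : e ∈ S
      · rw [hω', blockMap_apply_of_mem he0 heS] at he
        exact absurd he Bool.false_ne_true
      · rw [hω', blockMap_apply_of_notMem he₀ heS] at he
        rw [hends', blockEnds_apply_of_notMem he₀ heS] at hends
        exact conn_trans hy (conn_of_openAdj ⟨e, he, hends⟩)
  exact mem_of_conn_of_closed' hclosed hxT h

/-- **Connectivity through a two-terminal block**: for `x, z ∉ W`, `x ↔ z` in the collapsed
graph under the block map iff `x ↔ z` in the original graph under `ω`. -/
theorem conn_block_iff {ends : E → Sym2 V} {W : Set V} {u v : V} (hB : IsBlock ends W u v)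
    {S : Set E} [DecidablePred (· ∈ S)] (hS : ∀ e, e ∈ S ↔ e ∈ touches ends W) {e₀ : E}
    (he₀ : e₀ ∈ S) (ω : Config E) {x z : V} (hx : x ∉ W) (hz : z ∉ W) :
    Conn (blockEnds ends S e₀ u v) (blockMap S e₀ (blockObs ends S u v) ω) x z ↔
      Conn ends ω x z :=
  ⟨conn_of_conn_block he₀ rfl rfl, conn_block_of_conn hB hS he₀ rfl rfl hx hz⟩

end Conn

end Block

end Summit.Ventures.PercRepro2
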